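import Summits.PneNP.PneNP.Theses.ChebyshevTracialDesign
import Literature.Combinatorics.Optimization.TracialDesigns
import HarnessLib

/-!
# Route `ChebyshevTracialDesign`, item `PsdHyperplaneBound`: closed by the in-tree discharge

The route item `Summit.PneNP.PneNP.Theses.ChebyshevTracialDesign.PsdHyperplaneBound` is the named
statement `Literature.Combinatorics.Optimization.TracialHyperplaneBoundAt` (tracial hyperplane bound
at the dimension of the factorization with polynomial loss), PROVED in the tree as
`Literature.Combinatorics.Optimization.tracialHyperplaneBoundAt_holds`
(`Literature/Combinatorics/Optimization/TracialDesigns.lean`, elementary Auerbach rescaling,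
`p = 3`). Nothing is re-proved here (D-0059).
-/

set_option linter.dupNamespace false -- `Summit.PneNP.PneNP.…`: summit = sub-problem (D-0017)

namespace Summit.PneNP.PneNP.Theorems

/-- **Item `PsdHyperplaneBound` of route `ChebyshevTracialDesign`** — by the tree theorem
`Literature.Combinatorics.Optimization.tracialHyperplaneBoundAt_holds`.
[cite: BrietDadushPokutta2014, Thm. 6] -/
theorem PsdHyperplaneBound_proof : Summit.PneNP.PneNP.Theses.ChebyshevTracialDesign.PsdHyperplaneBound :=
  Literature.Combinatorics.Optimization.tracialHyperplaneBoundAt_holds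

end Summit.PneNP.PneNP.Theorems
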